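/-
COR-CM (cell pub-hodgecm2, stage 2 of the Hodge ladder) — count-neutral KERNEL COMBINATORICS «the binary tetrahedral group SL(2,3)», part XI: WORDS — the coset
normal form `cᵉ aˢ x_k` of a binary tetrahedral datum (seat prover-pub-hodgecm2-b23-g53-0, binder prover b23, gen 53; claim HOME/INBOX.md l.24246, NAME ASK
l.24300).  Bookkeeping definitions with bodies (`cpow`, `xk`, `word`, `wordEquiv`) + theorems on part I (`Census/BinaryTetrahedralDatum`) and part II BY NAME;
`decide` only on closed identities in `ZMod 2`/`ZMod 3`/`Fin 4`, no certificate, no named fact, no `sorry`.  `Interfaces.lean` (C1), every E term, B01,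
`Transposition/*`, `PortJoin/*`, `D2Bridge/*` untouched.
HONEST FRAMING: `HC_CM` is NOT proved, here or anywhere in the tree; nothing here is a period, a count of record or a headline.
T5: n/a-class (hypothesis binders = the fields of `BinaryTetrahedral.Datum`); checker: self.
-/
import Summits.HodgeConjecture.CorCM.Census.BinaryTetrahedralFloor
import Summits.HodgeConjecture.CorCM.Census.BinaryTetrahedralModel

/-!
# The binary tetrahedral group, XI: words — every element is `cᵉ aˢ x_k`, `x = (1, i, ij, j)`

For a binary tetrahedral datum `D : Datum G c` (`G ≅ SL(2,3)`): the cyclic subgroup `C = ⟨c⟩ × ⟨a⟩ ≅ ℤ/6` has the four right cosets `C·x_k`,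
`x = (x₀, x₁, x₂, x₃) = (1, i, ij, j)` (the coordinate order of the model of part IV), and **every element of `G` is uniquely a word
`word k (e, s) = cᵉ aˢ x_k`** (`e ∈ ℤ/2`, `s ∈ ℤ/3`, `k ∈ Fin 4`; `wordEquiv : Fin 4 × ℤ/2 × ℤ/3 ≃ G`) — exhaustion from part Iʼs normal form `iᵘ jᵛ aᵉ`
through the normality of `Q` (part II), uniqueness by counting.  Right multiplication by the generators moves the words exactly as the motions of the
model move coordinates: `word k (e,s)·i = word (σY k) (e + [k ∈ {1,3}], s)`, `word k (e,s)·(ij) = word (σT k) (e + [k ∈ {1,2}], s)`,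
`word k (e,s)·a = word (ρA k) (e, s + 1)`, `word k (e,s)·c = word k (e + 1, s)` (§3).  All [folklore].

## References
* [Pohlmann1968] H. Pohlmann, Algebraic cycles on abelian varieties of complex multiplication type, Ann. of Math. 88 (1968), Thm 1.
-/

namespace Summit.HodgeConjecture.CorCM.Census.BinaryTetrahedral

open Finset
open Summit.HodgeConjecture.CorCM.Census.QuarticInversion (σY σT)

noncomputable section

variable {G : Type*} [Group G] [Fintype G] [DecidableEq G] {c : G} (D : Datum G c)

/-! ## §1 The words -/

/-- `cᵉ` for `e ∈ ℤ/2`. [folklore] -/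
def cpow (c : G) (e : ZMod 2) : G := if e = 0 then 1 else c

/-- **The coset representatives** `x = (1, i, ij, j)` (the coordinate order of the model). [folklore] -/
def xk (k : Fin 4) : G := (![1, D.i, D.i * D.j, D.j] : Fin 4 → G) k

/-- **The word** `cᵉ aˢ x_k`. [folklore] -/
def word (k : Fin 4) (p : ZMod 2 × ZMod 3) : G := cpow c p.1 * D.a ^ p.2.val * xk D k

omit [Fintype G] [DecidableEq G] in
include D in
/-- `c·cᵉ = cᵉ⁺¹`. [folklore] -/
theorem c_mul_cpow (e : ZMod 2) : c * cpow c e = cpow c (e + 1) := by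
  have h01 : ∀ z : ZMod 2, z = 0 ∨ z = 1 := by decide
  rcases h01 e with rfl | rfl
  · simp only [cpow, if_true, mul_one, zero_add, one_ne_zero, if_false]
  · simp only [cpow, one_ne_zero, if_false, show (1 : ZMod 2) + 1 = 0 by decide, if_true, D.c_mul_c]

omit [DecidableEq G] in
include D in
/-- `cᵉ` commutes with everything (`c` is central). [folklore] -/
theorem cpow_comm (e : ZMod 2) (g : G) : cpow c e * g = g * cpow c e := by
  unfold cpow
  split_ifs
  · rw [one_mul, mul_one]
  · exact (D.hcen g).symm

omit [Fintype G] [DecidableEq G] in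
/-- **`c · word = word` with `e + 1`.** [folklore] -/
theorem c_mul_word (k : Fin 4) (e : ZMod 2) (s : ZMod 3) : c * word D k (e, s) = word D k (e + 1, s) := by
  simp only [word, ← mul_assoc, c_mul_cpow D]

omit [DecidableEq G] in
/-- **`word · c = word` with `e + 1`.** [folklore] -/
theorem word_mul_c (k : Fin 4) (e : ZMod 2) (s : ZMod 3) : word D k (e, s) * c = word D k (e + 1, s) := by
  rw [D.hcen, c_mul_word]

omit [Fintype G] [DecidableEq G] in
/-- `aˢ·a = aˢ⁺¹` with exponents in `ℤ/3` (`a³ = 1`). [folklore] -/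
theorem apow_mul_a (s : ZMod 3) : D.a ^ s.val * D.a = D.a ^ (s + 1).val := by
  rw [← pow_succ, ZMod.val_add, ZMod.val_one]
  conv_lhs => rw [← Nat.mod_add_div (s.val + 1) 3, pow_add, pow_mul, D.a_pow_three, one_pow, mul_one]

omit [Fintype G] [DecidableEq G] in
/-- `i a = a (ij)`, `(ij) a = a j`, `j a = a i` (`a` cycles `i ↦ j ↦ ij ↦ i`). [folklore] -/
theorem xk_mul_a (k : Fin 4) : xk D k * D.a = D.a * xk D (ρA k) := by
  have h1 : D.i * D.a = D.a * (D.i * D.j) := by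
    calc D.i * D.a = (D.a * (D.i * D.j) * D.a⁻¹) * D.a := by rw [D.a_mul_ij]
      _ = D.a * (D.i * D.j) := by group
  have h2 : D.i * D.j * D.a = D.a * D.j := by
    calc D.i * D.j * D.a = (D.a * D.j * D.a⁻¹) * D.a := by rw [D.haj]
      _ = D.a * D.j := by group
  have h3 : D.j * D.a = D.a * D.i := by
    calc D.j * D.a = (D.a * D.i * D.a⁻¹) * D.a := by rw [D.hai]
      _ = D.a * D.i := by group
  fin_cases k
  · show 1 * D.a = D.a * 1; rw [one_mul, mul_one]
  · exact h1
  · exact h2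
  · exact h3

omit [Fintype G] [DecidableEq G] in
/-- **`word · a`**: the coordinate index rotates by `ρA` and the slot advances. [folklore] -/
theorem word_mul_a (k : Fin 4) (e : ZMod 2) (s : ZMod 3) : word D k (e, s) * D.a = word D (ρA k) (e, s + 1) := by
  simp only [word]
  rw [mul_assoc, xk_mul_a, ← mul_assoc, mul_assoc (cpow c e), apow_mul_a]

omit [Fintype G] [DecidableEq G] in
/-- `x_k · i` in terms of the representatives: `i`, `c`, `j`, `c (ij)`. [folklore] -/
theorem xk_mul_i (k : Fin 4) : xk D k * D.i = cpow c ((![0, 1, 0, 1] : Fin 4 → ZMod 2) k) * xk D (σY k) := by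
  have hki : D.i * D.j * D.i = D.j := by
    calc D.i * D.j * D.i = D.i * (D.j * D.i) := by group
      _ = D.i * (c * D.i * D.j) := by rw [D.j_mul_i]
      _ = (D.i * c) * D.i * D.j := by group
      _ = c * (D.i * D.i) * D.j := by rw [D.commute_i_c.eq]; group
      _ = D.j := by rw [D.hii, D.c_mul_c, one_mul]
  fin_cases k
  · show 1 * D.i = cpow c 0 * D.i; rw [cpow, if_pos rfl]
  · show D.i * D.i = cpow c 1 * 1; rw [cpow, if_neg one_ne_zero, mul_one, D.hii]
  · show D.i * D.j * D.i = cpow c 0 * D.j; rw [cpow, if_pos rfl, one_mul, hki]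
  · show D.j * D.i = cpow c 1 * (D.i * D.j); rw [cpow, if_neg one_ne_zero, D.j_mul_i, mul_assoc]

omit [Fintype G] [DecidableEq G] in
/-- `x_k · (ij)`: `ij`, `c j`, `c`, `i`. [folklore] -/
theorem xk_mul_k (k : Fin 4) : xk D k * (D.i * D.j) = cpow c ((![0, 1, 1, 0] : Fin 4 → ZMod 2) k) * xk D (σT k) := by
  have hjk : D.j * (D.i * D.j) = D.i := by
    calc D.j * (D.i * D.j) = (D.j * D.i) * D.j := by group
      _ = c * D.i * (D.j * D.j) := by rw [D.j_mul_i]; group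
      _ = D.i := by rw [D.hjj, mul_assoc, D.commute_i_c.eq, ← mul_assoc, D.c_mul_c, one_mul]
  fin_cases k
  · show 1 * (D.i * D.j) = cpow c 0 * (D.i * D.j); rw [cpow, if_pos rfl]
  · show D.i * (D.i * D.j) = cpow c 1 * D.j; rw [cpow, if_neg one_ne_zero, ← mul_assoc, D.hii]
  · show D.i * D.j * (D.i * D.j) = cpow c 1 * 1; rw [cpow, if_neg one_ne_zero, mul_one, D.ij_mul_ij]
  · show D.j * (D.i * D.j) = cpow c 0 * D.i; rw [cpow, if_pos rfl, one_mul, hjk]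

omit [Fintype G] [DecidableEq G] in
include D in
/-- `cᵉ·cᵉ' = cᵉ⁺ᵉ'`. [folklore] -/
theorem cpow_mul_cpow (e e' : ZMod 2) : cpow c e * cpow c e' = cpow c (e + e') := by
  have h01 : ∀ z : ZMod 2, z = 0 ∨ z = 1 := by decide
  rcases h01 e with rfl | rfl
  · rw [cpow, if_pos rfl, one_mul, zero_add]
  · rw [show cpow c 1 = c by rw [cpow, if_neg one_ne_zero], c_mul_cpow D, add_comm]

omit [DecidableEq G] in
/-- **`word · i`**: index `σY k`, sign mask `(0,1,0,1)`. [folklore] -/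
theorem word_mul_i (k : Fin 4) (e : ZMod 2) (s : ZMod 3) :
    word D k (e, s) * D.i = word D (σY k) (e + (![0, 1, 0, 1] : Fin 4 → ZMod 2) k, s) := by
  simp only [word]
  rw [mul_assoc, xk_mul_i, ← mul_assoc, mul_assoc (cpow c e), ← cpow_comm D _ (D.a ^ s.val), ← mul_assoc, cpow_mul_cpow D]

omit [DecidableEq G] in
/-- **`word · (ij)`**: index `σT k`, sign mask `(0,1,1,0)`. [folklore] -/
theorem word_mul_k (k : Fin 4) (e : ZMod 2) (s : ZMod 3) :
    word D k (e, s) * (D.i * D.j) = word D (σT k) (e + (![0, 1, 1, 0] : Fin 4 → ZMod 2) k, s) := by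
  simp only [word]
  rw [mul_assoc, xk_mul_k, ← mul_assoc, mul_assoc (cpow c e), ← cpow_comm D _ (D.a ^ s.val), ← mul_assoc, cpow_mul_cpow D]

/-! ## §2 Exhaustion and uniqueness -/

omit [Fintype G] [DecidableEq G] in
/-- The quaternion words `iᵘ jᵛ` (`u < 4`, `v < 2`) are `cᵉ x_k`. [folklore] -/
theorem exists_eq_cpow_mul_xk {u v : ℕ} (hu : u < 4) (hv : v < 2) : ∃ (e : ZMod 2) (k : Fin 4), D.i ^ u * D.j ^ v = cpow c e * xk D k := by
  have hi2 : D.i ^ 2 = c := by rw [pow_two, D.hii]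
  have hi3 : D.i ^ 3 = c * D.i := by rw [pow_succ, hi2]
  interval_cases u <;> interval_cases v
  · exact ⟨0, 0, by simp [cpow, xk]⟩
  · exact ⟨0, 3, by simp [cpow, xk]⟩
  · exact ⟨0, 1, by simp [cpow, xk]⟩
  · exact ⟨0, 2, by simp [cpow, xk]⟩
  · exact ⟨1, 0, by simp [cpow, xk, hi2]⟩
  · exact ⟨1, 3, by simp [cpow, xk, hi2]⟩
  · exact ⟨1, 1, by simp [cpow, xk, hi3]⟩
  · exact ⟨1, 2, by simp [cpow, xk, hi3, mul_assoc]⟩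

omit [DecidableEq G] in
/-- **EXHAUSTION: every element is a word** `cᵉ aˢ x_k`. [folklore] -/
theorem exists_word (g : G) : ∃ k p, g = word D k p := by
  obtain ⟨u, hu, v, hv, e, he, rfl⟩ := D.exhaust g
  -- `iᵘ jᵛ aᵉ = aᵉ · (a⁻ᵉ iᵘ jᵛ aᵉ)` and the conjugate lies in `Q`
  have hq : (D.a ^ e)⁻¹ * (D.i ^ u * D.j ^ v) * (D.a ^ e)⁻¹⁻¹ ∈ D.Q := D.conj_mem_Q _ (D.word_mem_Q u v)
  rw [inv_inv] at hq
  obtain ⟨u', hu', v', hv', huv⟩ := D.exists_word_of_mem_Q hq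
  obtain ⟨ε, k, hk⟩ := exists_eq_cpow_mul_xk D hu' hv'
  refine ⟨k, (ε, (e : ZMod 3)), ?_⟩
  have hval : ((e : ZMod 3)).val = e := ZMod.val_natCast_of_lt he
  rw [word, hval]
  calc D.i ^ u * D.j ^ v * D.a ^ e = D.a ^ e * ((D.a ^ e)⁻¹ * (D.i ^ u * D.j ^ v) * D.a ^ e) := by group
    _ = D.a ^ e * (cpow c ε * xk D k) := by rw [huv, hk]
    _ = cpow c ε * D.a ^ e * xk D k := by rw [← mul_assoc, cpow_comm D]

omit [DecidableEq G] in
/-- **The word map is a bijection** `Fin 4 × ℤ/2 × ℤ/3 → G` (surjective between sets of `24` elements). [folklore] -/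
theorem word_bijective : Function.Bijective fun t : Fin 4 × ZMod 2 × ZMod 3 => word D t.1 t.2 := by
  classical
  rw [Fintype.bijective_iff_surjective_and_card]
  refine ⟨fun g => ?_, by simp [D.card_eq]⟩
  obtain ⟨k, p, rfl⟩ := exists_word D g
  exact ⟨(k, p), rfl⟩

/-- **The coset normal form as an equivalence** `Fin 4 × ℤ/2 × ℤ/3 ≃ G`. [folklore] -/
def wordEquiv : Fin 4 × ZMod 2 × ZMod 3 ≃ G := Equiv.ofBijective _ (word_bijective D)

omit [DecidableEq G] in
/-- `wordEquiv (k, p) = word k p`. [folklore] -/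
@[simp] theorem wordEquiv_apply (t : Fin 4 × ZMod 2 × ZMod 3) : wordEquiv D t = word D t.1 t.2 := rfl

omit [DecidableEq G] in
/-- `wordEquiv⁻¹ (word k p) = (k, p)`. [folklore] -/
@[simp] theorem wordEquiv_symm_word (k : Fin 4) (p : ZMod 2 × ZMod 3) : (wordEquiv D).symm (word D k p) = (k, p) :=
  (wordEquiv D).injective (by rw [Equiv.apply_symm_apply, wordEquiv_apply])

omit [DecidableEq G] in
/-- **Words are unique.** [folklore] -/
theorem word_eq_word_iff (k k' : Fin 4) (p p' : ZMod 2 × ZMod 3) : word D k p = word D k' p' ↔ k = k' ∧ p = p' := by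
  constructor
  · intro h
    have := (word_bijective D).1 (a₁ := (k, p)) (a₂ := (k', p')) h
    exact ⟨(Prod.mk.inj this).1, (Prod.mk.inj this).2⟩
  · rintro ⟨rfl, rfl⟩; rfl

/-! ## §3 Places -/

/-- **The place of a word**: `word n b ∈ {word k a, c·word k a}` iff `n = k` and the slots agree. [folklore] -/
theorem word_mem_orb_word_iff (n k : Fin 4) (b a : ZMod 2 × ZMod 3) :
    word D n b ∈ Prior.AllgGroup.RfwfAllgGroup.orb c (word D k a) ↔ n = k ∧ b.2 = a.2 := by
  obtain ⟨e, s⟩ := a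
  obtain ⟨e', s'⟩ := b
  rw [Prior.AllgGroup.RfwfAllgGroup.mem_orb, c_mul_word, word_eq_word_iff, word_eq_word_iff]
  constructor
  · rintro (⟨rfl, h⟩ | ⟨rfl, h⟩)
    · exact ⟨rfl, (Prod.mk.inj h).2⟩
    · exact ⟨rfl, (Prod.mk.inj h).2⟩
  · rintro ⟨rfl, hs⟩
    simp only at hs
    subst hs
    have h01 : ∀ z : ZMod 2, z = e ∨ z = e + 1 := by
      have : ∀ z w : ZMod 2, z = w ∨ z = w + 1 := by decide
      exact fun z => this z e
    rcases h01 e' with rfl | rfl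
    · exact Or.inl ⟨rfl, rfl⟩
    · exact Or.inr ⟨rfl, rfl⟩

/-- Words at distinct places of the model lie in distinct places of `G`. [folklore] -/
theorem word_not_mem_orb_of_ne {p q : Fin 4 × ZMod 3} (hpq : p ≠ q) :
    word D q.1 (0, q.2) ∉ Prior.AllgGroup.RfwfAllgGroup.orb c (word D p.1 (0, p.2)) := by
  rw [word_mem_orb_word_iff]
  rintro ⟨h1, h2⟩
  exact hpq (Prod.ext h1.symm h2.symm)

end

end Summit.HodgeConjecture.CorCM.Census.BinaryTetrahedral
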